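import Literature.MathematicalPhysics.QuantumFieldTheory.Balaban1983to89.Beta.ShellValue

/-!
# `Balaban1983to89.Beta.HomogSmooth` — every degree-`−4` homogeneous function that is `C¹` off the origin IS a
`DyadicShell.HomogKernel` (β sub-cell, lead's kernel node BETA-LEAD-HOMOGSMOOTH; fills the bookkeeping slot
«leading part ∈ HomogKernel» of BETA-SPEC §7.7 for the whole class of kernels the rows write down)

HONEST FRAMING (cell rule, verbatim): discharging `BetaPertH` makes Bałaban's UV stability UNCONDITIONAL — a real
constructive-QFT result; it is NOT the continuum limit and NOT the Clay problem.  (Gloss, BETA-SPEC v1.8d/v1.9b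
l. 17–18, GAPS G-ref2-14 (a) / G-ref2-20 (a), verbatim: «UNCONDITIONAL» in [Balaban1989LargeFieldII] (B16) p. 355's
interval-hypothesis sense ONLY (`FlowStepRuns.p355Unconditional_of_partialSums` keeps `hnodes`); the located leaves
G-adv3-2 (left inequality of (0.1)/(2.50), d = 4), G-adv3-1 (U2 transfer of B14 Cor. 3's lower bound) and `SecondExpLeaf`
REMAIN.)  THIS MODULE DISCHARGES NOTHING of the series and asserts nothing about Bałaban's β-functions: it is
first-year calculus on `ℝ⁴` (compactness + the mean-value inequality), composed BY NAME with `Beta.DyadicShell`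
(`HomogKernel`, `dyadicData_of_homogKernel`), `Beta.LeadingCoefficient` (`normSq`, `transverseUnit`) and
`Beta.ShellValue` (`midShell`).  Every declaration is `[folklore]`.  Value = a kernel utility for the CLASS of leading
kernels (audit cell `pub-balaban`, β sub-cell, unit `b2b-balaban-strat-b12` gen 6; specs `BETA-SPEC.md` v1.9c §7.7/§7.10,
`MISSING-B12.md` v3.6 §12.2 (vi)), NOT summit progress.  v1 p180305 (commit 5c034cae6dc6); v1.1 = §8 APPENDED, §1–§7 byte-identical.

WHY.  The wall of the β sub-cell is `LargeLWindow.WindowDecomposition β⁰ h …` with a leading lattice kernel `h` whose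
dyadic data feed `DyadicShell` / `ShellRiemann` / `ShellValue`; the continuum class used there is
`DyadicShell.HomogKernel F A Λ` = positively homogeneous of degree `−4` + `|F| ≤ A` on the unit sup-sphere + `Λ`-Lipschitz
on the closed sup-shell `{1/2 ≤ ‖x‖_∞ ≤ 2}`, with EXPLICIT constants.  So far every instance was certified by hand
(`DyadicShell.homogKernel_quarticR` with `1, 128`; `LeadingCoefficient.homogKernel_transverseUnit` with `24, 110592`).  The
leading kernels the analytic rows produce (item (vi) of BETA-SPEC §7.8: products of coordinates, of `1/|x|₂²` and of
its derivatives, contracted with constant vertex tensors) are rational functions of `x` and `|x|₂²`, smooth off the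
origin.  This file proves once and for all that smoothness off the origin suffices, the constants being produced by
compactness (the consumers `LargeLWindow.logGrowthLower` / `LargeL.thm2Printed` are existential in them anyway).

WHAT IS PROVED (0 sorry).
* §1 `IsHomog p F` — positive homogeneity of INTEGER degree `p` on `ℝ⁴ ∖ {0}` (`F (t • x) = t ^ p * F x`, `t > 0`,
  `x ≠ 0`): closed under `+`, `−`, real multiples, pointwise PRODUCT (degrees add), inverse and quotient (degrees
  subtract), finite sums; atoms: constants (degree `0`), coordinates `x ↦ x μ` (degree `1`), `normSq` (degree `2`);
  `IsHomog (-4) F ↔` the `homog` field of `HomogKernel`.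
* §2 the punctured space `punct = {0}ᶜ` (open) and the auxiliary compact shell `quarterShell = {1/4 ≤ ‖x‖_∞ ≤ 2}`,
  with `midShell ⊆ quarterShell ⊆ punct` and THE GEOMETRIC LEMMA: for `x, y ∈ midShell` with `‖y − x‖ ≤ 1/4` the whole
  segment `[x, y]` lies in `quarterShell` (the sup-shell itself is not convex — antipodal points see the origin — so the
  mean-value inequality is applied only on short segments).
* §3 `C¹` on `punct` ⟹ bounded on `midShell` (`exists_bound_midShell`), `fderiv` bounded on `quarterShell`
  (`exists_fderiv_bound`), hence LIPSCHITZ on `midShell` (`exists_lipschitz_midShell`): short pairs by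
  `Convex.norm_image_sub_le_of_norm_fderiv_le` on the segment, long pairs (`‖x − y‖ > 1/4`) by `2A ≤ 8A‖x − y‖`.
* §4 THE CONSTRUCTOR `exists_homogKernel`: `IsHomog (-4) F` + `ContDiffOn ℝ 1 F punct` ⟹ `∃ A Λ, HomogKernel F A Λ`;
  hence `exists_dyadicData`: `∃ C, DyadicData (F ∘ toReal) C` (by `DyadicShell.dyadicData_of_homogKernel`).
* §5 smoothness toolkit off the origin (`contDiff_coord`, `contDiff_normSq`, `contDiffOn_inv_normSq_pow`,
  `contDiffOn_div_normSq_pow`) and the RATIONAL-KERNEL corollary `exists_homogKernel_div_normSq_pow`: `F = P / normSq ^ m`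
  with `P ∈ C¹(ℝ⁴)` and `IsHomog (2m − 4) P`.
* §6 the FIELD FORM of item (vi) (lit1's `TransverseLink` shape): `h x = x μ * x ν * S x` with `S` of degree `−6` and
  `C¹` off the origin is a `HomogKernel` (`exists_homogKernel_fieldForm`; finite sums over index pairs:
  `exists_homogKernel_fieldForm_sum`).
* §7 sanity: `transverseUnit μ ν` recovered existentially by the machine (`exists_homogKernel_transverseUnit`).
* §8 (v1.1, append-only) SUB-LEADING TERMS: degree `p` + bounded on the unit sphere ⟹ `|F x| ≤ A‖x‖^p` off the origin
  (`abs_le_mul_zpow_of_isHomog`, existential forms); for degree `−5` on the lattice shells `annulus 4 r (r+1)` (where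
  `‖toReal w‖ = r + 1` exactly) this is LITERALLY the `g`-hypothesis of `LargeLWindow.WindowDecomposition.rem`:
  `|F (toReal w)| ≤ Cg/(r+1)^5` (`quintic_shell_bound`, `exists_quintic_shell_bound`).

NOT COVERED (honest): kernels that are only Lipschitz, e.g. `DyadicShell.quarticR = ‖x‖_∞⁻⁴` (the sup norm is not
`C¹`; its hand proof `homogKernel_quarticR` stands); explicit constants (use the hand route when numerics need them).
-/

namespace Literature.MathematicalPhysics.QuantumFieldTheory.Balaban1983to89.Beta.HomogSmooth

open Set Metric
open Literature.MathematicalPhysics.QuantumFieldTheory.Balaban1983to89.Beta.DyadicShell (HomogKernel DyadicData Pt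
  toReal dyadicData_of_homogKernel)
open Literature.MathematicalPhysics.QuantumFieldTheory.Balaban1983to89.Beta.LeadingCoefficient (normSq normSq_pos
  normSq_smul normSq_nonneg transverseUnit)
open Literature.MathematicalPhysics.QuantumFieldTheory.Balaban1983to89.Beta.ShellValue (midShell mem_midShell
  isCompact_midShell)

noncomputable section

/-- Real four-space with Mathlib's sup norm (the norm of `HomogKernel`). [folklore] -/
abbrev R4 : Type := Fin 4 → ℝ

variable {F G : R4 → ℝ} {p q : ℤ}

/-! ## 1. Positive homogeneity of integer degree -/

/-- `F` is positively homogeneous of integer degree `p` off the origin: `F (t • x) = t ^ p * F x` for `t > 0`,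
`x ≠ 0`. [folklore] -/
def IsHomog (p : ℤ) (F : R4 → ℝ) : Prop :=
  ∀ t : ℝ, 0 < t → ∀ x : R4, x ≠ 0 → F (t • x) = t ^ p * F x

namespace IsHomog

/-- Constants have degree `0`. [folklore] -/
theorem const (c : ℝ) : IsHomog 0 (fun _ => c) := by
  intro t _ x _
  simp

/-- The coordinate functions have degree `1`. [folklore] -/
theorem coord (μ : Fin 4) : IsHomog 1 (fun x => x μ) := by
  intro t _ x _
  simp [Pi.smul_apply, smul_eq_mul]

/-- `normSq = Σ xᵢ²` has degree `2`. [folklore] -/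
theorem normSq : IsHomog 2 normSq := by
  intro t _ x _
  rw [normSq_smul]
  norm_cast

/-- Sums of functions of the same degree. [folklore] -/
theorem add (hF : IsHomog p F) (hG : IsHomog p G) : IsHomog p (fun x => F x + G x) := by
  intro t ht x hx
  dsimp only
  rw [hF t ht x hx, hG t ht x hx]
  ring

/-- Differences of functions of the same degree. [folklore] -/
theorem sub (hF : IsHomog p F) (hG : IsHomog p G) : IsHomog p (fun x => F x - G x) := by
  intro t ht x hx
  dsimp only
  rw [hF t ht x hx, hG t ht x hx]
  ring

/-- Negation. [folklore] -/
theorem neg (hF : IsHomog p F) : IsHomog p (fun x => -F x) := by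
  intro t ht x hx
  dsimp only
  rw [hF t ht x hx]
  ring

/-- Real multiples. [folklore] -/
theorem const_mul (hF : IsHomog p F) (c : ℝ) : IsHomog p (fun x => c * F x) := by
  intro t ht x hx
  dsimp only
  rw [hF t ht x hx]
  ring

/-- Pointwise products: degrees ADD. [folklore] -/
theorem mul (hF : IsHomog p F) (hG : IsHomog q G) : IsHomog (p + q) (fun x => F x * G x) := by
  intro t ht x hx
  dsimp only
  rw [hF t ht x hx, hG t ht x hx, zpow_add₀ ht.ne']
  ring

/-- Natural powers: degree `n • p`. [folklore] -/
theorem pow (hF : IsHomog p F) (n : ℕ) : IsHomog (n * p) (fun x => F x ^ n) := by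
  intro t ht x hx
  dsimp only
  rw [hF t ht x hx, mul_pow, ← zpow_natCast, ← zpow_mul, mul_comm (p : ℤ)]

/-- Inverses: degree `−p` (no non-vanishing hypothesis is needed, `0⁻¹ = 0`). [folklore] -/
theorem inv (hF : IsHomog p F) : IsHomog (-p) (fun x => (F x)⁻¹) := by
  intro t ht x hx
  dsimp only
  rw [hF t ht x hx, mul_inv, zpow_neg]

/-- Quotients: degrees SUBTRACT. [folklore] -/
theorem div (hF : IsHomog p F) (hG : IsHomog q G) : IsHomog (p - q) (fun x => F x / G x) := by
  have h := hF.mul hG.inv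
  intro t ht x hx
  have h' := h t ht x hx
  dsimp only at h' ⊢
  rw [div_eq_mul_inv, div_eq_mul_inv, h', sub_eq_add_neg]

/-- Finite sums of functions of the same degree. [folklore] -/
theorem sum {ι : Type*} (s : Finset ι) {f : ι → R4 → ℝ} (hf : ∀ i ∈ s, IsHomog p (f i)) :
    IsHomog p (fun x => ∑ i ∈ s, f i x) := by
  intro t ht x hx
  dsimp only
  rw [Finset.mul_sum]
  exact Finset.sum_congr rfl fun i hi => hf i hi t ht x hx

/-- Change of the degree along an equality of integers (bookkeeping). [folklore] -/
theorem of_eq {p' : ℤ} (hF : IsHomog p F) (h : p = p') : IsHomog p' F := h ▸ hF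

/-- Degree `−4` in the `zpow` form is the `homog` field of `DyadicShell.HomogKernel` (`F (t • x) = F x / t ^ 4`).
[folklore] -/
theorem homog_div_form (hF : IsHomog (-4) F) :
    ∀ t : ℝ, 0 < t → ∀ x : R4, x ≠ 0 → F (t • x) = F x / t ^ 4 := by
  intro t ht x hx
  rw [hF t ht x hx, show (-4 : ℤ) = -((4 : ℕ) : ℤ) by norm_num, zpow_neg, zpow_natCast]
  rw [div_eq_mul_inv, mul_comm]

/-- Conversely a `HomogKernel` is `IsHomog (-4)`. [folklore] -/
theorem of_homogKernel {A Λ : ℝ} (hF : HomogKernel F A Λ) : IsHomog (-4) F := by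
  intro t ht x hx
  rw [hF.homog t ht x hx, show (-4 : ℤ) = -((4 : ℕ) : ℤ) by norm_num, zpow_neg, zpow_natCast]
  rw [div_eq_mul_inv, mul_comm]

end IsHomog

/-! ## 2. The punctured space and the two shells -/

/-- The punctured space `ℝ⁴ ∖ {0}`. [folklore] -/
def punct : Set R4 := ({0} : Set R4)ᶜ

/-- Membership in the punctured space. [folklore] -/
theorem mem_punct {x : R4} : x ∈ punct ↔ x ≠ 0 := Set.mem_compl_singleton_iff

/-- The punctured space is open. [folklore] -/
theorem isOpen_punct : IsOpen punct := isOpen_compl_singleton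

/-- The auxiliary shell `{1/4 ≤ ‖x‖_∞ ≤ 2}`. [folklore] -/
def quarterShell : Set R4 := closedBall 0 2 ∩ {x | 1 / 4 ≤ ‖x‖}

/-- Membership in the auxiliary shell. [folklore] -/
theorem mem_quarterShell {x : R4} : x ∈ quarterShell ↔ 1 / 4 ≤ ‖x‖ ∧ ‖x‖ ≤ 2 := by
  rw [quarterShell, Set.mem_inter_iff, mem_closedBall_zero_iff, Set.mem_setOf_eq]
  exact and_comm

/-- The auxiliary shell is compact. [folklore] -/
theorem isCompact_quarterShell : IsCompact quarterShell :=
  (isCompact_closedBall (0 : R4) 2).inter_right (isClosed_le continuous_const continuous_norm)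

/-- A point of norm at least `1/4` is not the origin. [folklore] -/
theorem ne_zero_of_norm_ge {x : R4} {c : ℝ} (hc : 0 < c) (hx : c ≤ ‖x‖) : x ≠ 0 := by
  intro h
  rw [h, norm_zero] at hx
  linarith

/-- `midShell ⊆ quarterShell`. [folklore] -/
theorem midShell_subset_quarterShell : midShell ⊆ quarterShell := by
  intro x hx
  obtain ⟨h1, h2⟩ := mem_midShell.mp hx
  exact mem_quarterShell.mpr ⟨by linarith, h2⟩

/-- `quarterShell ⊆ punct`. [folklore] -/
theorem quarterShell_subset_punct : quarterShell ⊆ punct := by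
  intro x hx
  obtain ⟨h1, _⟩ := mem_quarterShell.mp hx
  exact mem_punct.mpr (ne_zero_of_norm_ge (by norm_num) h1)

/-- `midShell ⊆ punct`. [folklore] -/
theorem midShell_subset_punct : midShell ⊆ punct :=
  midShell_subset_quarterShell.trans quarterShell_subset_punct

/-- THE GEOMETRIC LEMMA: a short segment between shell points stays in the auxiliary shell.  If `x, y ∈ midShell` and
`‖y − x‖ ≤ 1/4` then `segment ℝ x y ⊆ quarterShell`. [folklore] -/
theorem segment_subset_quarterShell {x y : R4} (hx : x ∈ midShell) (hy : y ∈ midShell) (hxy : ‖y - x‖ ≤ 1 / 4) :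
    segment ℝ x y ⊆ quarterShell := by
  intro z hz
  obtain ⟨a, b, ha, hb, hab, rfl⟩ := hz
  obtain ⟨hx1, hx2⟩ := mem_midShell.mp hx
  obtain ⟨_, hy2⟩ := mem_midShell.mp hy
  refine mem_quarterShell.mpr ⟨?_, ?_⟩
  · -- `a • x + b • y = x + b • (y - x)`, so its norm is at least `‖x‖ − b‖y − x‖ ≥ 1/2 − 1/4`
    have heq : a • x + b • y = x + b • (y - x) := by
      have ha' : a = 1 - b := by linarith
      rw [ha', sub_smul, one_smul, smul_sub]
      abel
    have h1 : ‖x‖ ≤ ‖a • x + b • y‖ + ‖b • (y - x)‖ := by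
      have := norm_sub_le (a • x + b • y) (b • (y - x))
      rw [heq, add_sub_cancel_right] at this
      rw [heq]
      exact this
    have h2 : ‖b • (y - x)‖ ≤ 1 / 4 := by
      rw [norm_smul, Real.norm_of_nonneg hb]
      calc b * ‖y - x‖ ≤ 1 * (1 / 4) := by gcongr; linarith
        _ = 1 / 4 := one_mul _
    linarith
  · calc ‖a • x + b • y‖ ≤ ‖a • x‖ + ‖b • y‖ := norm_add_le _ _
      _ = a * ‖x‖ + b * ‖y‖ := by rw [norm_smul, norm_smul, Real.norm_of_nonneg ha, Real.norm_of_nonneg hb]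
      _ ≤ a * 2 + b * 2 := by gcongr
      _ = 2 := by rw [← add_mul, hab, one_mul]

/-! ## 3. `C¹` off the origin ⟹ bounded and Lipschitz on the shell -/

/-- A function continuous on the (compact) shell is bounded there by some `A ≥ 0`. [folklore] -/
theorem exists_bound_midShell (hc : ContinuousOn F midShell) : ∃ A : ℝ, 0 ≤ A ∧ ∀ x ∈ midShell, |F x| ≤ A := by
  obtain ⟨A, hA⟩ := isCompact_midShell.exists_bound_of_continuousOn hc
  refine ⟨max A 0, le_max_right _ _, fun x hx => ?_⟩
  have := hA x hx
  rw [Real.norm_eq_abs] at this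
  exact this.trans (le_max_left _ _)

/-- `C¹` on the punctured space ⟹ continuous on the shell. [folklore] -/
theorem continuousOn_midShell_of_contDiffOn (hF : ContDiffOn ℝ 1 F punct) : ContinuousOn F midShell :=
  hF.continuousOn.mono midShell_subset_punct

/-- `C¹` on the punctured space ⟹ the derivative is bounded on the auxiliary compact shell. [folklore] -/
theorem exists_fderiv_bound (hF : ContDiffOn ℝ 1 F punct) :
    ∃ M : ℝ, 0 ≤ M ∧ ∀ x ∈ quarterShell, ‖fderiv ℝ F x‖ ≤ M := by
  have hcont : ContinuousOn (fun x => fderiv ℝ F x) quarterShell :=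
    (hF.continuousOn_fderiv_of_isOpen isOpen_punct le_rfl).mono quarterShell_subset_punct
  obtain ⟨M, hM⟩ := isCompact_quarterShell.exists_bound_of_continuousOn hcont
  exact ⟨max M 0, le_max_right _ _, fun x hx => (hM x hx).trans (le_max_left _ _)⟩

/-- `C¹` on the punctured space ⟹ differentiable at every point off the origin. [folklore] -/
theorem differentiableAt_of_contDiffOn (hF : ContDiffOn ℝ 1 F punct) {x : R4} (hx : x ≠ 0) :
    DifferentiableAt ℝ F x :=
  (hF.differentiableOn one_ne_zero).differentiableAt (isOpen_punct.mem_nhds (mem_punct.mpr hx))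

/-- THE LIPSCHITZ ESTIMATE on the non-convex sup-shell: `C¹` on the punctured space ⟹ `∃ Λ ≥ 0`,
`|F x − F y| ≤ Λ‖x − y‖` for all `x, y ∈ midShell`.  Short pairs (`‖x − y‖ ≤ 1/4`) by the mean-value inequality on
the segment (which lies in `quarterShell`), long pairs by the bound `2A ≤ 8A‖x − y‖`. [folklore] -/
theorem exists_lipschitz_midShell (hF : ContDiffOn ℝ 1 F punct) :
    ∃ Λ : ℝ, 0 ≤ Λ ∧ ∀ x ∈ midShell, ∀ y ∈ midShell, |F x - F y| ≤ Λ * ‖x - y‖ := by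
  obtain ⟨A, hA0, hA⟩ := exists_bound_midShell (continuousOn_midShell_of_contDiffOn hF)
  obtain ⟨M, hM0, hM⟩ := exists_fderiv_bound hF
  refine ⟨M + 8 * A, by positivity, fun x hx y hy => ?_⟩
  by_cases hclose : ‖y - x‖ ≤ 1 / 4
  · -- mean-value inequality on the segment
    have hseg := segment_subset_quarterShell hx hy hclose
    have hdiff : ∀ z ∈ segment ℝ x y, DifferentiableAt ℝ F z := fun z hz =>
      differentiableAt_of_contDiffOn hF (mem_punct.mp (quarterShell_subset_punct (hseg hz)))
    have hbd : ∀ z ∈ segment ℝ x y, ‖fderiv ℝ F z‖ ≤ M := fun z hz => hM z (hseg hz)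
    have hmv := Convex.norm_image_sub_le_of_norm_fderiv_le hdiff hbd (convex_segment x y)
      (left_mem_segment ℝ x y) (right_mem_segment ℝ x y)
    rw [Real.norm_eq_abs] at hmv
    rw [abs_sub_comm, norm_sub_rev]
    calc |F y - F x| ≤ M * ‖y - x‖ := hmv
      _ ≤ (M + 8 * A) * ‖y - x‖ := by gcongr; linarith
  · -- far pairs: the trivial bound
    rw [not_le, norm_sub_rev] at hclose
    calc |F x - F y| ≤ |F x| + |F y| := abs_sub _ _
      _ ≤ A + A := add_le_add (hA x hx) (hA y hy)
      _ = 8 * A * (1 / 4) := by ring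
      _ ≤ 8 * A * ‖x - y‖ := by gcongr
      _ ≤ (M + 8 * A) * ‖x - y‖ := by gcongr; linarith

/-! ## 4. The constructor: homogeneous of degree `−4` and `C¹` off the origin ⟹ `HomogKernel` -/

/-- **THE CONSTRUCTOR.**  A function on `ℝ⁴` that is positively homogeneous of degree `−4` and `C¹` on `ℝ⁴ ∖ {0}` is a
`DyadicShell.HomogKernel` for SOME constants `A, Λ` (produced by compactness). [folklore] -/
theorem exists_homogKernel (hh : IsHomog (-4) F) (hF : ContDiffOn ℝ 1 F punct) : ∃ A Λ : ℝ, HomogKernel F A Λ := by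
  obtain ⟨A, hA0, hA⟩ := exists_bound_midShell (continuousOn_midShell_of_contDiffOn hF)
  obtain ⟨Λ, hΛ0, hΛ⟩ := exists_lipschitz_midShell hF
  refine ⟨A, Λ, ⟨hA0, hΛ0, hh.homog_div_form, fun x hx => hA x ?_, fun x y hx1 hx2 hy1 hy2 => ?_⟩⟩
  · exact mem_midShell.mpr ⟨by rw [hx]; norm_num, by rw [hx]; norm_num⟩
  · exact hΛ x (mem_midShell.mpr ⟨hx1, hx2⟩) y (mem_midShell.mpr ⟨hy1, hy2⟩)

/-- The same with the smoothness hypothesis in the `{x | x ≠ 0}` spelling. [folklore] -/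
theorem exists_homogKernel' (hh : IsHomog (-4) F) (hF : ContDiffOn ℝ 1 F {x : R4 | x ≠ 0}) :
    ∃ A Λ : ℝ, HomogKernel F A Λ := by
  have hs : {x : R4 | x ≠ 0} = punct := by
    ext x; rw [mem_punct]; rfl
  exact exists_homogKernel hh (hs ▸ hF)

/-- **Corollary for the window machinery**: such a function, restricted to `ℤ⁴`, satisfies `DyadicShell.DyadicData`
for some constant (so `DyadicShell.dyadicRate`, the window logarithm, `ShellRiemann.coeff_eq_integral` and
`ShellValue.integral_shell_eq_log_mul_angAvg` all apply to it). [folklore] -/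
theorem exists_dyadicData (hh : IsHomog (-4) F) (hF : ContDiffOn ℝ 1 F punct) :
    ∃ C : ℝ, DyadicData (fun w : Pt => F (toReal w)) C := by
  obtain ⟨A, Λ, hK⟩ := exists_homogKernel hh hF
  exact ⟨A + Λ, dyadicData_of_homogKernel hK⟩


/-! ## 5. Smoothness off the origin: atoms and the rational-kernel corollary -/

/-- The coordinate functions are smooth. [folklore] -/
theorem contDiff_coord (μ : Fin 4) {n : WithTop ℕ∞} : ContDiff ℝ n (fun x : R4 => x μ) :=
  contDiff_apply ℝ ℝ μ

/-- `normSq` is smooth (a polynomial). [folklore] -/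
theorem contDiff_normSq {n : WithTop ℕ∞} : ContDiff ℝ n (normSq : R4 → ℝ) := by
  unfold Literature.MathematicalPhysics.QuantumFieldTheory.Balaban1983to89.Beta.LeadingCoefficient.normSq
  exact ContDiff.sum fun i _ => (contDiff_coord i).pow 2

/-- `normSq` does not vanish off the origin. [folklore] -/
theorem normSq_ne_zero_of_mem_punct {x : R4} (hx : x ∈ punct) : normSq x ≠ 0 :=
  (normSq_pos (mem_punct.mp hx)).ne'

/-- Powers of `normSq` in the denominator are smooth off the origin. [folklore] -/
theorem contDiffOn_inv_normSq_pow (m : ℕ) {n : WithTop ℕ∞} :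
    ContDiffOn ℝ n (fun x : R4 => (normSq x ^ m)⁻¹) punct :=
  (contDiff_normSq.pow m).contDiffOn.inv fun _ hx => pow_ne_zero m (normSq_ne_zero_of_mem_punct hx)

/-- A quotient `P / normSq ^ m` with `P ∈ C¹(ℝ⁴)` is `C¹` off the origin. [folklore] -/
theorem contDiffOn_div_normSq_pow {P : R4 → ℝ} (hP : ContDiff ℝ 1 P) (m : ℕ) :
    ContDiffOn ℝ 1 (fun x : R4 => P x / normSq x ^ m) punct :=
  hP.contDiffOn.div ((contDiff_normSq.pow m).contDiffOn) fun _ hx => pow_ne_zero m (normSq_ne_zero_of_mem_punct hx)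

/-- Degree bookkeeping for `P / normSq ^ m`: if `P` has degree `2m − 4` the quotient has degree `−4`. [folklore] -/
theorem isHomog_div_normSq_pow {P : R4 → ℝ} {m : ℕ} (hP : IsHomog (2 * m - 4) P) :
    IsHomog (-4) (fun x => P x / normSq x ^ m) := by
  have h := hP.div (IsHomog.normSq.pow m)
  exact h.of_eq (by ring)

/-- **RATIONAL KERNELS.**  `F = P / normSq ^ m` with `P ∈ C¹(ℝ⁴)` positively homogeneous of degree `2m − 4` off the
origin is a `HomogKernel` for some constants. [folklore] -/
theorem exists_homogKernel_div_normSq_pow {P : R4 → ℝ} {m : ℕ} (hP : ContDiff ℝ 1 P) (hh : IsHomog (2 * m - 4) P) :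
    ∃ A Λ : ℝ, HomogKernel (fun x => P x / normSq x ^ m) A Λ :=
  exists_homogKernel (isHomog_div_normSq_pow hh) (contDiffOn_div_normSq_pow hP m)

/-! ## 6. The field form of item (vi): `h = x_μ x_ν · S` with `S` of degree `−6` -/

/-- **FIELD FORM** (the shape of `Beta.TransverseLink`): if `S : ℝ⁴ → ℝ` is positively homogeneous of degree `−6` and
`C¹` off the origin then `x ↦ x μ * x ν * S x` is a `HomogKernel` for some constants. [folklore] -/
theorem exists_homogKernel_fieldForm {S : R4 → ℝ} (hS : IsHomog (-6) S) (hS1 : ContDiffOn ℝ 1 S punct) (μ ν : Fin 4) :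
    ∃ A Λ : ℝ, HomogKernel (fun x => x μ * x ν * S x) A Λ := by
  refine exists_homogKernel ?_ ?_
  · exact (((IsHomog.coord μ).mul (IsHomog.coord ν)).mul hS).of_eq (by norm_num)
  · exact (((contDiff_coord μ).mul (contDiff_coord ν)).contDiffOn).mul hS1

/-- The same for a finite SUM over index pairs, `x ↦ Σ_{(μ,ν) ∈ s} x μ * x ν * S μ ν x` (e.g. a full contraction).
[folklore] -/
theorem exists_homogKernel_fieldForm_sum {S : Fin 4 → Fin 4 → R4 → ℝ} (s : Finset (Fin 4 × Fin 4))
    (hS : ∀ μ ν, IsHomog (-6) (S μ ν)) (hS1 : ∀ μ ν, ContDiffOn ℝ 1 (S μ ν) punct) :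
    ∃ A Λ : ℝ, HomogKernel (fun x => ∑ a ∈ s, x a.1 * x a.2 * S a.1 a.2 x) A Λ := by
  refine exists_homogKernel ?_ ?_
  · exact IsHomog.sum s fun a _ => (((IsHomog.coord a.1).mul (IsHomog.coord a.2)).mul (hS a.1 a.2)).of_eq (by norm_num)
  · exact ContDiffOn.sum fun a _ => (((contDiff_coord a.1).mul (contDiff_coord a.2)).contDiffOn).mul (hS1 a.1 a.2)

/-! ## 7. Sanity: the transverse structure recovered by the machine -/

/-- `transverseUnit μ ν = 24 (x_μ x_ν)² / normSq⁴` has degree `−4`. [folklore] -/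
theorem isHomog_transverseUnit (μ ν : Fin 4) : IsHomog (-4) (transverseUnit μ ν) := by
  have h : IsHomog (2 * (4 : ℕ) - 4) (fun x : R4 => 24 * (x μ * x ν) ^ 2) :=
    ((((IsHomog.coord μ).mul (IsHomog.coord ν)).pow 2).const_mul 24).of_eq (by norm_num)
  exact isHomog_div_normSq_pow h

/-- `transverseUnit μ ν` is `C¹` off the origin. [folklore] -/
theorem contDiffOn_transverseUnit (μ ν : Fin 4) : ContDiffOn ℝ 1 (transverseUnit μ ν) punct := by
  have hP : ContDiff ℝ 1 (fun x : R4 => 24 * (x μ * x ν) ^ 2) :=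
    contDiff_const.mul (((contDiff_coord μ).mul (contDiff_coord ν)).pow 2)
  exact contDiffOn_div_normSq_pow hP 4

/-- The transverse structure is a `HomogKernel` for SOME constants — the existential shadow of
`LeadingCoefficient.homogKernel_transverseUnit` (which has the explicit `24, 110592`), obtained here with no
computation. [folklore] -/
theorem exists_homogKernel_transverseUnit (μ ν : Fin 4) : ∃ A Λ : ℝ, HomogKernel (transverseUnit μ ν) A Λ :=
  exists_homogKernel (isHomog_transverseUnit μ ν) (contDiffOn_transverseUnit μ ν)


/-! ## 8. (v1.1) Sub-leading homogeneous terms: size `C·‖x‖^p` off the origin, and on the lattice shells the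
`rem`-slot shape `|g w| ≤ Cg/(r+1)^5` of `LargeLWindow.WindowDecomposition` for degree `−5` -/

/-- Normalising a nonzero point to the unit sup-sphere. [folklore] -/
theorem norm_inv_smul_eq_one {x : R4} (hx : x ≠ 0) : ‖(‖x‖⁻¹ : ℝ) • x‖ = 1 := by
  have hn : 0 < ‖x‖ := norm_pos_iff.mpr hx
  rw [norm_smul, norm_inv, norm_norm, inv_mul_cancel₀ hn.ne']

/-- **Size of a homogeneous function off the origin.**  If `F` has degree `p` and is bounded by `A` on the unit
sup-sphere then `|F x| ≤ A·‖x‖^p` for every `x ≠ 0`. [folklore] -/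
theorem abs_le_mul_zpow_of_isHomog {A : ℝ} (hh : IsHomog p F) (hA : ∀ u : R4, ‖u‖ = 1 → |F u| ≤ A) {x : R4}
    (hx : x ≠ 0) : |F x| ≤ A * ‖x‖ ^ p := by
  have hn : 0 < ‖x‖ := norm_pos_iff.mpr hx
  set u : R4 := (‖x‖⁻¹ : ℝ) • x with hu
  have hu1 : ‖u‖ = 1 := norm_inv_smul_eq_one hx
  have hune : u ≠ 0 := by
    intro h; rw [h, norm_zero] at hu1; exact zero_ne_one hu1
  have hxu : x = ‖x‖ • u := by
    rw [hu, smul_smul, mul_inv_cancel₀ hn.ne', one_smul]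
  have key : F x = ‖x‖ ^ p * F u := by
    conv_lhs => rw [hxu]
    exact hh ‖x‖ hn u hune
  rw [key, abs_mul, abs_of_pos (zpow_pos hn p), mul_comm]
  exact mul_le_mul_of_nonneg_right (hA u hu1) (zpow_pos hn p).le

/-- Existential form: degree `p` and continuity on the shell give `∃ C ≥ 0, |F x| ≤ C·‖x‖^p` off the origin.
[folklore] -/
theorem exists_abs_le_mul_zpow (hh : IsHomog p F) (hc : ContinuousOn F midShell) :
    ∃ C : ℝ, 0 ≤ C ∧ ∀ x : R4, x ≠ 0 → |F x| ≤ C * ‖x‖ ^ p := by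
  obtain ⟨A, hA0, hA⟩ := exists_bound_midShell hc
  refine ⟨A, hA0, fun x hx => abs_le_mul_zpow_of_isHomog hh (fun u hu => hA u ?_) hx⟩
  exact mem_midShell.mpr ⟨by rw [hu]; norm_num, by rw [hu]; norm_num⟩

/-- The same from `C¹` (indeed from mere continuity) off the origin. [folklore] -/
theorem exists_abs_le_mul_zpow_of_contDiffOn (hh : IsHomog p F) (hF : ContDiffOn ℝ 1 F punct) :
    ∃ C : ℝ, 0 ≤ C ∧ ∀ x : R4, x ≠ 0 → |F x| ≤ C * ‖x‖ ^ p :=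
  exists_abs_le_mul_zpow hh (continuousOn_midShell_of_contDiffOn hF)

/-- On the lattice: a point of the shell `annulus 4 r (r+1)` has real sup-norm EXACTLY `r + 1`. [folklore] -/
theorem norm_toReal_of_mem_annulus {r : ℕ} {w : Pt}
    (hw : w ∈ Literature.Probability.LatticeModels.annulus 4 r (r + 1)) : ‖toReal w‖ = (r : ℝ) + 1 := by
  obtain ⟨h1, h2⟩ := DyadicShell.mem_annulus_iff.mp hw
  have : DyadicShell.supNorm w = r + 1 := le_antisymm h2 h1
  rw [DyadicShell.norm_toReal, this]
  push_cast
  ring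

/-- **THE `rem`-SLOT SHAPE.**  A function of degree `−5`, bounded by `A` on the unit sup-sphere, restricted to `ℤ⁴`,
satisfies the quintic shell bound of `LargeLWindow.WindowDecomposition.rem`:
`|F (toReal w)| ≤ A/(r+1)^5` for `w ∈ annulus 4 r (r+1)`. [folklore] -/
theorem quintic_shell_bound {A : ℝ} (hh : IsHomog (-5) F) (hA : ∀ u : R4, ‖u‖ = 1 → |F u| ≤ A) (r : ℕ) (w : Pt)
    (hw : w ∈ Literature.Probability.LatticeModels.annulus 4 r (r + 1)) :
    |F (toReal w)| ≤ A / ((r : ℝ) + 1) ^ 5 := by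
  have hw0 : toReal w ≠ 0 := by
    rw [Ne, DyadicShell.toReal_eq_zero_iff]
    exact DyadicShell.ne_zero_of_mem_annulus hw
  have h := abs_le_mul_zpow_of_isHomog hh hA hw0
  rw [norm_toReal_of_mem_annulus hw, show (-5 : ℤ) = -((5 : ℕ) : ℤ) by norm_num, zpow_neg, zpow_natCast] at h
  rwa [div_eq_mul_inv]

/-- Existential lattice form from `C¹` off the origin: `∃ Cg ≥ 0, ∀ r, ∀ w ∈ annulus 4 r (r+1), |F (toReal w)| ≤ Cg/(r+1)^5`
— literally the hypothesis on `g` in `LargeLWindow.WindowDecomposition.rem` (for an `L`-, `k`-independent sub-leading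
term). [folklore] -/
theorem exists_quintic_shell_bound (hh : IsHomog (-5) F) (hF : ContDiffOn ℝ 1 F punct) :
    ∃ Cg : ℝ, 0 ≤ Cg ∧ ∀ r : ℕ, ∀ w ∈ Literature.Probability.LatticeModels.annulus 4 r (r + 1),
      |F (toReal w)| ≤ Cg / ((r : ℝ) + 1) ^ 5 := by
  obtain ⟨A, hA0, hA⟩ := exists_bound_midShell (continuousOn_midShell_of_contDiffOn hF)
  refine ⟨A, hA0, fun r w hw => quintic_shell_bound hh (fun u hu => hA u ?_) r w hw⟩
  exact mem_midShell.mpr ⟨by rw [hu]; norm_num, by rw [hu]; norm_num⟩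

end

end Literature.MathematicalPhysics.QuantumFieldTheory.Balaban1983to89.Beta.HomogSmooth
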